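/-
Origin: expansion seat `prover-pub-hodgecm-mc-sinst-1-g9-0`, handover #1240 2026-08-20T21:25Z md5 faa5ebfc6b54 (208 l.; NEW additive leaf, ns HodgeCM.Model / HodgeCM.Model.ThetaAdelicSide; imports #1239 + #R114 + #R94; §1 abbrev `ratBall γ` (= toBall of a rational point along the uniform frame), `frameIso_frameOf_glι` (frameIso 𝔣_Δ γ^{ι₁} = toBall γ), `trPull_mem_H10` (t_γ^* of a (1,0)-class is (1,0), `hI`), **`pull_trPull_apply`** (MODEL form of #R94 classLift_pull_mulVec: the harmonic pull-back of t_γ^* cl is x ↦ pull cl (toBall γ · x)), `eq_of_pull_eq`, `ratBall_one`; §2 `ThetaAdelicSide.towerFamily` (h ↦ #1239 compClass F h ∈ H¹(P_(Γ.conj h))), **`towerFamily_mem`** (∈ towerLevel … Γ hΓ for S.ιinf = archInfOf V — binder-1's criterion #R114 with #1239 compAt_rationalToFinAdelic_mul), **`res_towerFamily`** (TowerLevel.res = the (1,0)-class with pull = F ∘ S.ιinf), `exists_towerLevel_res_eq` (= first clause of #R115's `hfam`); NAME LIST: HodgeCM.Model.pull_trPull_apply · HodgeCM.Model.ThetaAdelicSide.towerFamily_mem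 · HodgeCM.Model.ThetaAdelicSide.res_towerFamily) (`HOME/mc/pub-hodgecm-mc-sinst-1-g9/stage64/HodgeCM/Model/AdelicThetaTowerClass.lean`, md5 faa5ebfc6b54, 208 lines);
landed by the second packager p2 gen 14 (p2-g14) in gate run 64 as `HodgeCM/Model/AdelicThetaTowerClass.lean` (verbatim).
-/
/-
Copyright (c) 2026 the pub-hodgecm formalisation cell (harness21).  New file, not vendored.
Origin: session prover-pub-hodgecm-mc-sinst-1-g9-0 (unit pub-hodgecm-mc-sinst-1-g9, S-INSTANCE CONSTRUCTOR gen 9; the (J2)↔(J4) seam of the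
(J-Liu-Θ) junction behind E's row 9 `hΘ` — binder-1-g16's word «yours», STATUS 2026-08-20T20:51:41Z), 2026-08-20.
Intended final place: `HodgeCM/Model/AdelicThetaTowerClass.lean` (NEW additive model-layer leaf; imports sinst-1's
`HodgeCM.Model.AdelicThetaComponents` (#1239), binder-1's `HodgeCM.Model.TowerLevelCriterion` (#R114) and `HodgeCM.Model.ClassLiftTwist`
(#R94); nothing imports it; drop alone).
-/
import Summits.HodgeConjecture.HodgeCM.Model.AdelicThetaComponents_2
import Summits.HodgeConjecture.HodgeCM.Model.TowerLevelCriterion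
import Summits.HodgeConjecture.HodgeCM.Model.ClassLiftTwist

set_option autoImplicit false

/-!
# The cohomological theta family: component classes of a saturated adèlic theta form are a member of `towerLevel`

For an adelic side `S : ThetaAdelicSide V c` (anisotropic regime `hV`), a level `Γ` below a conjugate of `K_f(3)` and an element `F`
of the slot's adèlic theta module SATURATED at `satLevelRegimeOf V hV Γ.K` with HOLOMORPHIC GERMS along `S.ιinf`, #1239 built the
component classes `S.compClass … F h ∈ F¹H¹(P_{Γ.conj h})` (`pull (compClass F h) = compAt F h = (x ↦ F (S.ιinf x · finToG V hV h))`).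
Here:

§1 the MODEL form of the (α2)-twist #R94: **`pull_trPull_apply`** — for a `(1,0)`-class `cl` of `P_{Δ₂}` and a rational translate
  `t_γ : P_{Δ₁} ⟶ P_{Δ₂}` (binder-1 #R107 `transMorU`, `trPull`), `t_γ^* cl` is a `(1,0)`-class of `P_{Δ₁}` (`trPull_mem_H10`) and its
  harmonic pull-back is the LEFT TRANSLATE `x ↦ pull cl (γ̃ · x)`, `γ̃ = toBall γ ∈ U(2,1)` (`classLift_pull_mulVec` + `map_transMor_unif` +
  `classPull_apply_mul_left`; `frameIso_frameOf_glι`: under the uniform Sylvester frame `frameIso 𝔣_Δ γ^{ι₁} = toBall γ`);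
§2 **`towerFamily S … hF hhol ∈ towerLevel … Γ hΓ`** (`towerFamily_mem`) for adelic sides with the honest archimedean component
  (`S.ιinf = archInfOf V`, the S of record): binder-1's criterion #R114 `mem_towerLevel_of_translate_of_invariant`, the two clauses being
  #1239's `compAt_rationalToFinAdelic_mul` (rational translates, `k := 1`; and `γ := 1` for right-`K`-invariance) read through §1 and
  the injectivity of the pin's class map; and **`res_towerFamilyL`**: `TowerLevel.res` of the family is THE `(1,0)`-class of `P_Γ` whose
  pull-back is `F ∘ S.ιinf` — so for a theta class `ω` with such a lift `F`, `∃ c ∈ towerLevel, TowerLevel.res c = ω`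
  (`exists_towerLevel_res_eq`), the first clause of binder-1's `hfam` (#R115 `subset_span_of_tower`).
KERNEL only: 0 records, 0 `def … : Prop`, nothing cited; `#print axioms` ⊆ {propext, Classical.choice, Quot.sound}.
-/

noncomputable section

open MulAction NumberField
open Literature.NumberTheory.Automorphic Literature.NumberTheory.Weil1964
open Literature.NumberTheory.Automorphic.WeightForms (restrictHom thetaClasses IsLevelCorrected IsWeightMatched)
open Literature.Geometry.ComplexHyperbolic.BallModel (U21 x₀ mat)
open Literature.AlgebraicGeometry.HodgeTheory Literature.AlgebraicGeometry.ShimuraVarieties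
open Literature.AlgebraicGeometry.Motives (bettiCohomology)
open Literature.NumberTheory.Automorphic.PicardCM
open Literature.NumberTheory.Transcendental (Arapura2012_Cor_15_4_6)
open HodgeCM.Model.SupplyResidual HodgeCM.Model.ThetaSpace HodgeCM.Model.LevelTranslate HodgeCM.Model.TowerLevel

namespace HodgeCM
namespace Model

variable (hHD : exists_isReal_hodgeModel) (hI : hodgePQ_independent_of_hodgeModel)
  (h₁ : BallQuotientUniformised) (h₃ : CMAbelianVarietyRealised) (hA : Arapura2012_Cor_15_4_6)
variable {L : CMField} {ι₁ : L →+* ℂ} {V : HermSpace3 L ι₁}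

/-! ## §1. Pull-backs of `(1,0)`-classes along rational translates are left translates of their harmonic pull-backs -/

/-- The `U(2,1)`-avatar `T⁻¹ γ^{ι₁} T` of a rational point `γ ∈ U(V)(L⁺)` along the uniform Sylvester frame. -/
abbrev ratBall (γ : ↥(Urat V)) : U21 :=
  BallRational.toBall L ι₁ V.Hm V.sylvesterFrame (sylvesterFrame_J V) ⟨(γ : GL (Fin 3) L), γ.2⟩

/-- **Under the uniform frame, `frameIso 𝔣_Δ (γ^{ι₁}) = toBall γ`.** -/
theorem frameIso_frameOf_glι (hV : IsAnisotropic L V.Hm) (Δ : Level V) (γ : ↥(Urat V)) :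
    (ballDatumOf (hHD := hHD) (hI := hI) (hU := ballQuotientUniformisedDatum_of h₁) (h₃ := h₃) L ι₁ V Δ hV).frameIso
        (frameOf hHD hI h₁ h₃ Δ hV)
        ⟨glι ι₁ (γ : GL (Fin 3) L), map_ι₁_mem_realPoints (ballQuotientUniformisedDatum_of h₁) h₃ γ.2 Δ
          ((isAnisotropic_pmsCode_iff L ι₁ V Δ).2 hV)⟩ =
      ratBall γ := by
  apply Subtype.ext
  apply Units.ext
  change mat _ = mat _
  rw [UnitaryBallUniformisationDatum.mat_frameIso, BallRational.mat_toBall]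
  rfl

/-- `t_γ^*` of a `(1,0)`-class is a `(1,0)`-class (the Hodge filtration is preserved by pull-backs, `hI`). -/
theorem trPull_mem_H10 (hV : IsAnisotropic L V.Hm) {γ : ↥(Urat V)} {Δ₁ Δ₂ : Level V}
    (ht : TransCond (γ : GL (Fin 3) L) Δ₁ Δ₂) (cl : (pinD hHD hI h₁ h₃ Δ₂ hV).H10) :
    trPull hHD hI (ballQuotientUniformisedDatum_of h₁) h₃ hA γ Δ₁ Δ₂ ht 1
        (cl : (picardCMUniverse hHD hI h₁ h₃).CohC ((picardCMUniverse hHD hI h₁ h₃).pms L ι₁ V Δ₂) 1) ∈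
      (pinD hHD hI h₁ h₃ Δ₁ hV).H10 :=
  BettiUniverse.pull_hodge hHD hI
    (ballDatumOf (hHD := hHD) (hI := hI) (hU := ballQuotientUniformisedDatum_of h₁) (h₃ := h₃) L ι₁ V Δ₁ hV).isSmoothProjective
    (ballDatumOf (hHD := hHD) (hI := hI) (hU := ballQuotientUniformisedDatum_of h₁) (h₃ := h₃) L ι₁ V Δ₂ hV).isSmoothProjective
    (transMor (ballQuotientUniformisedDatum_of h₁) h₃ hHD hA γ.2 Δ₁ Δ₂ ht) 1 1 (Submodule.mem_map_of_mem cl.2)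

/-- **The harmonic pull-back of `t_γ^* cl` is the left translate `x ↦ pull cl (γ̃ · x)`**, `γ̃ = toBall γ` — the MODEL form of the
(α2)-twist #R94 `classLift_pull_mulVec` (with binder-1's `map_transMor_unif` and the uniform frame). -/
theorem pull_trPull_apply (hV : IsAnisotropic L V.Hm) {γ : ↥(Urat V)} {Δ₁ Δ₂ : Level V}
    (ht : TransCond (γ : GL (Fin 3) L) Δ₁ Δ₂) (cl : (pinD hHD hI h₁ h₃ Δ₂ hV).H10) (x : U21) :
    ((pinD hHD hI h₁ h₃ Δ₁ hV).pull ⟨_, trPull_mem_H10 hHD hI h₁ h₃ hA hV ht cl⟩).1 x =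
      ((pinD hHD hI h₁ h₃ Δ₂ hV).pull cl).1 (ratBall γ * x) := by
  have hmv := ClassLiftTwist.classLift_pull_mulVec
    (D := ballDatumOf (hHD := hHD) (hI := hI) (hU := ballQuotientUniformisedDatum_of h₁) (h₃ := h₃) L ι₁ V Δ₂ hV)
    (ballDatumOf (hHD := hHD) (hI := hI) (hU := ballQuotientUniformisedDatum_of h₁) (h₃ := h₃) L ι₁ V Δ₁ hV)
    (f := transMor (ballQuotientUniformisedDatum_of h₁) h₃ hHD hA γ.2 Δ₁ Δ₂ ht)
    (𝔣 := frameOf hHD hI h₁ h₃ Δ₂ hV) (frameOf hHD hI h₁ h₃ Δ₁ hV)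
    ⟨glι ι₁ (γ : GL (Fin 3) L), map_ι₁_mem_realPoints (ballQuotientUniformisedDatum_of h₁) h₃ γ.2 Δ₂
      ((isAnisotropic_pmsCode_iff L ι₁ V Δ₂).2 hV)⟩ hHD hI rfl
    (fun v hv => map_transMor_unif (ballQuotientUniformisedDatum_of h₁) h₃ hHD hA γ.2 ht hV hv) cl.2
  rw [frameIso_frameOf_glι] at hmv
  show ((ballDatumOf (hHD := hHD) (hI := hI) (hU := ballQuotientUniformisedDatum_of h₁) (h₃ := h₃) L ι₁ V Δ₁ hV).classPull
        hHD (frameOf hHD hI h₁ h₃ Δ₁ hV)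
        ((BettiUniverse.pull (transMor (ballQuotientUniformisedDatum_of h₁) h₃ hHD hA γ.2 Δ₁ Δ₂ ht) 1).baseChange ℂ
          (cl : (picardCMUniverse hHD hI h₁ h₃).CohC ((picardCMUniverse hHD hI h₁ h₃).pms L ι₁ V Δ₂) 1)) : U21 → Fin 2 → ℂ) x =
      ((ballDatumOf (hHD := hHD) (hI := hI) (hU := ballQuotientUniformisedDatum_of h₁) (h₃ := h₃) L ι₁ V Δ₂ hV).classPull
        hHD (frameOf hHD hI h₁ h₃ Δ₂ hV)
        (cl : (picardCMUniverse hHD hI h₁ h₃).CohC ((picardCMUniverse hHD hI h₁ h₃).pms L ι₁ V Δ₂) 1) : U21 → Fin 2 → ℂ) (ratBall γ * x)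
  rw [UnitaryBallUniformisationDatum.classPull_apply_mul_left, UnitaryBallUniformisationDatum.coe_classPull]
  exact congrArg (fun Lf => AutomorphyFactor.toGroupFun BallForms.cotangentCocycle x₀ Lf x) hmv


/-- Two `(1,0)`-classes of `P_Δ` with the same harmonic pull-back are equal (injectivity of the pin's class map). -/
theorem eq_of_pull_eq (hV : IsAnisotropic L V.Hm) {Δ : Level V} (a b : (pinD hHD hI h₁ h₃ Δ hV).H10)
    (h : ((pinD hHD hI h₁ h₃ Δ hV).pull a).1 = ((pinD hHD hI h₁ h₃ Δ hV).pull b).1) :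
    (a : (picardCMUniverse hHD hI h₁ h₃).CohC ((picardCMUniverse hHD hI h₁ h₃).pms L ι₁ V Δ) 1) = b :=
  congrArg Subtype.val
    (classMapDatumOf_pull_injective hHD hI h₁ h₃ Δ hV _ (MonoidHom.id U21) _ _ (Subtype.ext h))

/-- `toBall` of the identity of `U(V)(L⁺)` (in the `Urat` spelling) is `1`. -/
theorem ratBall_one : ratBall (V := V) 1 = 1 := map_one _

/-! ## §2. The cohomological theta family of a saturated adèlic theta form with holomorphic germs -/

namespace ThetaAdelicSide

variable {c : SeesawCtx L} (S : ThetaAdelicSide V c)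
variable {𝓕 : Set C(NumberField.relNormOneIdeles (↥(maximalRealSubfield L)) L ⧸
    NumberField.relNormOneRat (↥(maximalRealSubfield L)) L, ℂ)}

/-- **The cohomological theta family** of `F`: `h ↦` the component class `compClass F h ∈ H¹(P_{Γ.conj h})` (#1239). -/
def towerFamily (hV : IsAnisotropic L V.Hm) {k : Fin 4} {Γ : Level V} (hΓ : Γ.BelowConjThree)
    {F : (V.latticeModel printFact_unitaryCompact_holds).G → (Fin 2 → ℂ)}
    (hF : F ∈ adelicThetaSpanSat (S.P k) S.ιinf (stabilizer U21 x₀).subtype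
      (BallForms.isPullbackCocycle_cotangentCocycle.weightOf x₀) (satLevelRegimeOf V hV Γ.K) 𝓕)
    (hhol : IsHolGerm S.ιinf F) :
    Π h : V.adelicFin, TowerLevel.W hHD hI (ballQuotientUniformisedDatum_of h₁) h₃ Γ hΓ h :=
  fun h => (S.compClass hHD hI h₁ h₃ hV hΓ hF hhol h :
    (picardCMUniverse hHD hI h₁ h₃).CohC ((picardCMUniverse hHD hI h₁ h₃).pms L ι₁ V (Γ.conj h hΓ)) 1)

/-- (Ported verbatim from the HodgeCMPerL package; no docstring in the source.) -/
theorem towerFamily_apply (hV : IsAnisotropic L V.Hm) {k : Fin 4} {Γ : Level V} (hΓ : Γ.BelowConjThree)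
    {F : (V.latticeModel printFact_unitaryCompact_holds).G → (Fin 2 → ℂ)}
    (hF : F ∈ adelicThetaSpanSat (S.P k) S.ιinf (stabilizer U21 x₀).subtype
      (BallForms.isPullbackCocycle_cotangentCocycle.weightOf x₀) (satLevelRegimeOf V hV Γ.K) 𝓕)
    (hhol : IsHolGerm S.ιinf F) (h : V.adelicFin) :
    S.towerFamily hHD hI h₁ h₃ hV hΓ hF hhol h = (S.compClass hHD hI h₁ h₃ hV hΓ hF hhol h).1 := rfl

/-- **The cohomological theta family is a member of the level-`K` carrier `towerLevel`** (adelic sides with the honest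
archimedean component): binder-1's criterion #R114, clause (i) = rational translates, clause (ii) = right-`K`-invariance, both from
#1239 `compAt_rationalToFinAdelic_mul` read through `pull_trPull_apply` and the injectivity of the class map. -/
theorem towerFamily_mem (hι : S.ιinf = archInfOf V) (hV : IsAnisotropic L V.Hm) {k : Fin 4} {Γ : Level V}
    (hΓ : Γ.BelowConjThree) {F : (V.latticeModel printFact_unitaryCompact_holds).G → (Fin 2 → ℂ)}
    (hF : F ∈ adelicThetaSpanSat (S.P k) S.ιinf (stabilizer U21 x₀).subtype
      (BallForms.isPullbackCocycle_cotangentCocycle.weightOf x₀) (satLevelRegimeOf V hV Γ.K) 𝓕)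
    (hhol : IsHolGerm S.ιinf F) :
    S.towerFamily hHD hI h₁ h₃ hV hΓ hF hhol ∈ towerLevel hHD hI (ballQuotientUniformisedDatum_of h₁) h₃ hA Γ hΓ := by
  refine mem_towerLevel_of_translate_of_invariant hHD hI (ballQuotientUniformisedDatum_of h₁) h₃ hA hΓ _
    (fun γ h => ?_) (fun h kK hk => ?_)
  · refine eq_of_pull_eq hHD hI h₁ h₃ hV (S.compClass hHD hI h₁ h₃ hV hΓ hF hhol h)
      ⟨_, trPull_mem_H10 hHD hI h₁ h₃ hA hV _ (S.compClass hHD hI h₁ h₃ hV hΓ hF hhol (ρ V γ * h))⟩ (funext fun x => ?_)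
    rw [pull_trPull_apply, S.pull_compClass, S.pull_compClass]
    have e := S.compAt_rationalToFinAdelic_mul hι hV hF ⟨(γ : GL (Fin 3) L), γ.2⟩ h (one_mem Γ.K) x
    rw [mul_one] at e
    exact e.symm
  · refine eq_of_pull_eq hHD hI h₁ h₃ hV (S.compClass hHD hI h₁ h₃ hV hΓ hF hhol h)
      ⟨_, trPull_mem_H10 hHD hI h₁ h₃ hA hV _ (S.compClass hHD hI h₁ h₃ hV hΓ hF hhol (h * kK))⟩ (funext fun x => ?_)
    rw [pull_trPull_apply, S.pull_compClass, S.pull_compClass]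
    have e := S.compAt_rationalToFinAdelic_mul hι hV hF ⟨((1 : ↥(Urat V)) : GL (Fin 3) L), (1 : ↥(Urat V)).2⟩ h hk x
    have e1 : UnitaryGroup.rationalToFinAdelic (↥(maximalRealSubfield L)) (L : Type) (IsCMField.complexConj L) 3 V.Hm
        (UnitaryGroup.ballRational (L : Type) V.Hm ⟨((1 : ↥(Urat V)) : GL (Fin 3) L), (1 : ↥(Urat V)).2⟩) = 1 :=
      map_one (ρ V)
    rw [e1, one_mul] at e
    exact e.symm

/-- **`TowerLevel.res` of the family is THE `(1,0)`-class of `P_Γ` whose harmonic pull-back is `F ∘ S.ιinf`.** -/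
theorem res_towerFamily (hV : IsAnisotropic L V.Hm) {k : Fin 4} {Γ : Level V} (hΓ : Γ.BelowConjThree)
    {F : (V.latticeModel printFact_unitaryCompact_holds).G → (Fin 2 → ℂ)}
    (hF : F ∈ adelicThetaSpanSat (S.P k) S.ιinf (stabilizer U21 x₀).subtype
      (BallForms.isPullbackCocycle_cotangentCocycle.weightOf x₀) (satLevelRegimeOf V hV Γ.K) 𝓕)
    (hhol : IsHolGerm S.ιinf F)
    (hc : S.towerFamily hHD hI h₁ h₃ hV hΓ hF hhol ∈ towerLevel hHD hI (ballQuotientUniformisedDatum_of h₁) h₃ hA Γ hΓ)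
    (cl : (pinD hHD hI h₁ h₃ Γ hV).H10) (hcl : ((pinD hHD hI h₁ h₃ Γ hV).pull cl).1 = F ∘ S.ιinf) :
    TowerLevel.res hHD hI (ballQuotientUniformisedDatum_of h₁) h₃ hA ⟨_, hc⟩ =
      (cl : (picardCMUniverse hHD hI h₁ h₃).CohC ((picardCMUniverse hHD hI h₁ h₃).pms L ι₁ V Γ) 1) := by
  rw [TowerLevel.res_apply]
  refine (eq_of_pull_eq hHD hI h₁ h₃ hV cl
    ⟨_, trPull_mem_H10 hHD hI h₁ h₃ hA hV _ (S.compClass hHD hI h₁ h₃ hV hΓ hF hhol 1)⟩ (funext fun x => ?_)).symm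
  rw [pull_trPull_apply, S.pull_compClass, hcl, ratBall_one, one_mul, compAt_apply, map_one, mul_one]
  rfl

/-- **First clause of binder-1's `hfam`**: a `(1,0)`-class of `P_Γ` whose harmonic pull-back is the archimedean restriction
of a saturated adèlic theta form with holomorphic germs is `TowerLevel.res` of a member of `towerLevel`. -/
theorem exists_towerLevel_res_eq (hι : S.ιinf = archInfOf V) (hV : IsAnisotropic L V.Hm) {k : Fin 4} {Γ : Level V}
    (hΓ : Γ.BelowConjThree) {F : (V.latticeModel printFact_unitaryCompact_holds).G → (Fin 2 → ℂ)}
    (hF : F ∈ adelicThetaSpanSat (S.P k) S.ιinf (stabilizer U21 x₀).subtype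
      (BallForms.isPullbackCocycle_cotangentCocycle.weightOf x₀) (satLevelRegimeOf V hV Γ.K) 𝓕)
    (hhol : IsHolGerm S.ιinf F) (cl : (pinD hHD hI h₁ h₃ Γ hV).H10)
    (hcl : ((pinD hHD hI h₁ h₃ Γ hV).pull cl).1 = F ∘ S.ιinf) :
    ∃ cf : towerLevel hHD hI (ballQuotientUniformisedDatum_of h₁) h₃ hA Γ hΓ,
      TowerLevel.res hHD hI (ballQuotientUniformisedDatum_of h₁) h₃ hA cf =
        (cl : (picardCMUniverse hHD hI h₁ h₃).CohC ((picardCMUniverse hHD hI h₁ h₃).pms L ι₁ V Γ) 1) :=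
  ⟨⟨_, S.towerFamily_mem hHD hI h₁ h₃ hA hι hV hΓ hF hhol⟩,
    S.res_towerFamily hHD hI h₁ h₃ hA hV hΓ hF hhol _ cl hcl⟩

end ThetaAdelicSide

end Model
end HodgeCM

end
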